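import Summits.BirchSwinnertonDyer.BirchSwinnertonDyer.Theorems.BiquadraticEisensteinDescentHeegnerTwistCouplingInSupplyQuarticTwistDescentDual
import Summits.BirchSwinnertonDyer.BirchSwinnertonDyer.Theorems.BiquadraticEisensteinDescentHeegnerTwistCouplingInSupplyCornersThreeFacts
import Literature.NumberTheory.EllipticCurves.ComplexMultiplicationHasCMProofs
import Literature.NumberTheory.EllipticCurves.ComplexMultiplicationMaximalOrderProofs
import Literature.NumberTheory.EllipticCurves.ComplexMultiplicationShaHeckeProofs
import Literature.NumberTheory.EllipticCurves.ComplexMultiplicationLFunctionTableProofs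
import Literature.NumberTheory.EllipticCurves.BSDSelmerCMPConverse
import Literature.NumberTheory.EllipticCurves.AnalyticRankOrderProofs
import Literature.NumberTheory.EllipticCurves.NonEisensteinPrimeOfSurjective
import Literature.NumberTheory.EllipticCurves.CongruentNumberCurveSupersingular
import Literature.NumberTheory.EllipticCurves.LFunctionPrimeCoeff
import Literature.NumberTheory.EllipticCurves.QuadraticTwist
import Literature.NumberTheory.EllipticCurves.XCubeAddDXTorsion
import HarnessLib

set_option linter.dupNamespace false -- `Summit.BirchSwinnertonDyer.BirchSwinnertonDyer.Theorems.…` (summit = sub)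
set_option autoImplicit false

/-!
# Crux `HeegnerTwistCouplingInSupply` (stmt-BirchSwinnertonDyer-21381) — the QUARTIC `j = 1728` corner, III:
# ★ `W = W_p⁻ : y² = x³ − p·x`, every prime `p ≡ 7 (mod 8)` with `p ≡ 4 (mod 5)`, modulo Burungale–Tian + Deuring–Hecke

Route `BiquadraticEisensteinDescent` (cell `pub/bsd-wall`, width seat `bsd-wall-cm-bed-w4` g13; `--supports` 21381, helper;
LEAD-VERDICT-ibd-p1-g11 §4 (ii) «other `j = 1728` curves»). The first NON-congruent corner of the crux's habitat: `W_p⁻ : y² = x³ − px`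
has CM by `ℤ[i]` (`j = 1728`), `p ≡ 3 (mod 4)` is inert in `ℚ(i)` and bad, and for `p ≡ 7 (mod 8)` the `2`-Selmer parity is odd
(`S(0,−p) = {1,−p}`, `S(0,4p) = {1,2,p,2p}`) — the rank-one habitat; it has ONE rational `2`-torsion point, so Monsky's matrices do not
apply but Silverman's descent via `2`-isogeny does (siblings `…QuarticTwistLocal/Descent/DescentDual`).

* §1 the family: `W_p⁻^{(d)} = ⟨0, 0, 0, −d²p, 0⟩`, `j = 1728`, `HasCM`, the `ℤ`-model `⟨0,0,0,−p,0⟩` with `Δ = 64p³`, good reduction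
  at every prime `r ∤ 2p`, hence every prime divisor of `N(W_p⁻)` is `2` or `p` (no modularity);
* §2 ★ `rank_sha_corank_twist`: for primes `p ≡ 7 (mod 8)`, `p ≡ 4 (mod 5)`, `q ≡ 3 (mod 8)` with `(q/p) = −1`, the twist
  `E = W_p⁻^{(−5q)} : y² = x³ − 25pq²x` has `rank E(ℚ) = 0`, `Ш(E/ℚ)[2] = 0` and `corank_{ℤ₂} Sel_{2^∞}(E/ℚ) = 0` — UNCONDITIONAL
  (Silverman X.4.7 with X.4.2(a) counted by the tree's `natCard_sha_inf_range_eq_one_of_selmerRank_add_le`: `dim₂ S + dim₂ S′ = 2`);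
* §3 ★★ `cruxOnQuarticCorner_of_two_facts`: for EVERY prime `p ≡ 7 (mod 8)`, `p ≡ 4 (mod 5)` (i.e. `p ≡ 39 (mod 40)`): a Heegner field
  `K′ = ℚ(√−5q)` of `N(W_p⁻)` with `4 < |d_{K′}|`, `L(W_p⁻^{(d_{K′})}, 1) ≠ 0`, `h(K′) < p` and `p ∤ h(K′)` — the CONCLUSION of crux 21381
  on this family — modulo Burungale–Tian (`hBT`, rank-zero `2`-converse for CM curves) and Deuring–Hecke (`hH`, continuation of `L` for
  `j ∈ maximalCMJInvariants`) ONLY. The auxiliary prime `q ≡ 3 (mod 8)` with `(−5q/p) = +1` and `h(−5q) < p` is the UNCONDITIONAL cell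
  datum of `…CornersThreeFacts.exists_cellData_two_p` (three-squares / indefinite pins + class number formula bound); the field is
  `…IndefinitePinWitness.exists_witnessField_five_of`.

Why `p ≡ 4 (mod 5)`: with the partner `5` the descent is sharp iff `p` is a square but not a fourth power modulo `5`; for `p ≡ 1 (mod 5)`
it is blind (`dim₂ S = dim₂ S′ = 2`), and every PRIME Heegner twist is blind for all `p` (numerics in the crux memo). HONEST FRAMING:
a typed sub-corner on one more CM family (measure zero in «all CM `W`»; density `1/4` of the habitat `p ≡ 7 (mod 8)`); the crux (residual
C⁺) is untouched; 21381 is NOT closed by corner theorems; BSD is not proved by any of this. THEOREMS ONLY. Supports stmt-BirchSwinnertonDyer-21381.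
-/

noncomputable section

open scoped Classical NumberField

namespace Summit.BirchSwinnertonDyer.BirchSwinnertonDyer.Theorems.BiquadraticEisensteinDescentHeegnerTwistCouplingInSupplyQuarticTwistCorner

open _root_.WeierstrassCurve Literature.NumberTheory.EllipticCurves
open IsDedekindDomain Rat.HeightOneSpectrum
open Summit.BirchSwinnertonDyer.BirchSwinnertonDyer.Theorems.BiquadraticEisensteinDescentHeegnerTwistCouplingInSupplyQuarticTwistLocal
open Summit.BirchSwinnertonDyer.BirchSwinnertonDyer.Theorems.BiquadraticEisensteinDescentHeegnerTwistCouplingInSupplyQuarticTwistDescent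
open Summit.BirchSwinnertonDyer.BirchSwinnertonDyer.Theorems.BiquadraticEisensteinDescentHeegnerTwistCouplingInSupplyQuarticTwistDescentDual
open Summit.BirchSwinnertonDyer.BirchSwinnertonDyer.Theorems.BiquadraticEisensteinDescentHeegnerTwistCouplingInSupplyCornersThreeFacts
open Summit.BirchSwinnertonDyer.BirchSwinnertonDyer.Theorems.BiquadraticEisensteinDescentHeegnerTwistCouplingInSupplyIndefinitePinWitness

/-! ## §1 The family `W_p⁻ : y² = x³ − p·x` -/

section Family

/-- **Twisting the quartic family**: `(y² = x³ − px)^{(d)} = (y² = x³ − d²p·x)`, written in the literal of the descent files.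
[cite: SilvermanAEC2009, X.2 and X.5] -/
theorem quadraticTwist_W (p : ℕ) (d : ℤ) :
    (⟨0, 0, 0, -(p : ℚ), 0⟩ : WeierstrassCurve ℚ).quadraticTwist (d : ℚ) =
      ⟨0, ((0 : ℤ) : ℚ), 0, ((-(d ^ 2 * p) : ℤ) : ℚ), 0⟩ := by
  rw [quadraticTwist_mk]; ext <;> push_cast <;> ring

/-- **`j(y² = x³ + Ax) = 1728`** (`j = 256(a² − 3b)³/(b²(a² − 4b))` with `a = 0`). [cite: SilvermanAEC2009, X.6 (E_D has j = 1728)] -/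
theorem j_quartic {A : ℚ} (hA : A ≠ 0) [hE : (⟨0, 0, 0, A, 0⟩ : WeierstrassCurve ℚ).IsElliptic] :
    (⟨0, 0, 0, A, 0⟩ : WeierstrassCurve ℚ).j = 1728 := by
  rw [j_mk_twoTorsion]
  rw [div_eq_iff (by rw [show A ^ 2 * ((0 : ℚ) ^ 2 - 4 * A) = -4 * A ^ 3 by ring]; exact mul_ne_zero (by norm_num) (pow_ne_zero 3 hA))]
  ring

/-- The descent literal `⟨0, ↑0, 0, ↑A, 0⟩` is the clean quartic literal. [folklore] -/
theorem lit_eq (A : ℤ) :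
    (⟨0, ((0 : ℤ) : ℚ), 0, (A : ℚ), 0⟩ : WeierstrassCurve ℚ) = ⟨0, 0, 0, (A : ℚ), 0⟩ := by
  ext <;> push_cast <;> ring

/-- `j = 1728` and CM for the descent literal `⟨0, ↑0, 0, ↑A, 0⟩`, `A ≠ 0`. [cite: SilvermanAEC2009, X.6 and App. C §11] -/
theorem j_and_hasCM_lit {A : ℤ} (hA : A ≠ 0) [hE : (⟨0, ((0 : ℤ) : ℚ), 0, (A : ℚ), 0⟩ : WeierstrassCurve ℚ).IsElliptic] :
    (⟨0, ((0 : ℤ) : ℚ), 0, (A : ℚ), 0⟩ : WeierstrassCurve ℚ).j = 1728 ∧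
      (⟨0, ((0 : ℤ) : ℚ), 0, (A : ℚ), 0⟩ : WeierstrassCurve ℚ).HasCM := by
  have hA' : (A : ℚ) ≠ 0 := by exact_mod_cast hA
  haveI : (⟨0, 0, 0, (A : ℚ), 0⟩ : WeierstrassCurve ℚ).IsElliptic := XCubeAddDX.isElliptic_xD hA
  have hj : (⟨0, ((0 : ℤ) : ℚ), 0, (A : ℚ), 0⟩ : WeierstrassCurve ℚ).j = 1728 := by
    have h := j_quartic hA'
    simp only [← lit_eq] at h
    convert h
  exact ⟨hj, Literature.NumberTheory.EllipticCurves.hasCM_of_j_eq_1728 _ hj⟩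

/-- The `ℤ`-model `⟨0, 0, 0, −p, 0⟩` maps to `W_p⁻`. [folklore] -/
theorem map_WInt (p : ℕ) :
    (⟨0, 0, 0, -(p : ℤ), 0⟩ : WeierstrassCurve ℤ).map (Int.castRingHom ℚ) = ⟨0, 0, 0, -(p : ℚ), 0⟩ := by
  ext <;> simp [WeierstrassCurve.map]

/-- `Δ(⟨0, 0, 0, −p, 0⟩) = 64p³`. [cite: SilvermanAEC2009, III.1 (b₂, b₄, b₆, b₈, Δ)] -/
theorem WInt_Δ (p : ℕ) : (⟨0, 0, 0, -(p : ℤ), 0⟩ : WeierstrassCurve ℤ).Δ = 64 * (p : ℤ) ^ 3 := by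
  simp only [WeierstrassCurve.Δ, WeierstrassCurve.b₂, WeierstrassCurve.b₄, WeierstrassCurve.b₆, WeierstrassCurve.b₈]
  ring

/-- A prime `r ∤ 2p` does not divide `Δ = 64p³`. [folklore] -/
theorem not_dvd_WInt_Δ {p r : ℕ} (hr : r.Prime) (hrp : ¬ r ∣ 2 * p) :
    ¬ (r : ℤ) ∣ (⟨0, 0, 0, -(p : ℤ), 0⟩ : WeierstrassCurve ℤ).Δ := by
  rw [WInt_Δ]
  intro h
  have h'' : r ∣ 64 * p ^ 3 := by exact_mod_cast h
  rcases (Nat.Prime.dvd_mul hr).mp h'' with h64 | hp3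
  · exact hrp ((hr.dvd_of_dvd_pow (show r ∣ 2 ^ 6 by simpa using h64)).mul_right p)
  · exact hrp ((hr.dvd_of_dvd_pow hp3).mul_left 2)

/-- **`W_p⁻` has good reduction at every prime `r ∤ 2p`** (`r ∤ Δ` of the `ℤ`-model; Silverman VII.5.1(a), prime-indexed form).
[cite: SilvermanAEC2009, VII.5 Prop. 5.1(a)] -/
theorem hasGoodReductionAtPrime_W {p r : ℕ} [Fact r.Prime] (hrp : ¬ r ∣ 2 * p) :
    (⟨0, 0, 0, -(p : ℚ), 0⟩ : WeierstrassCurve ℚ).HasGoodReductionAtPrime r := by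
  obtain ⟨v, rfl⟩ : ∃ v : HeightOneSpectrum (𝓞 ℚ), (primesEquiv v : ℕ) = r :=
    ⟨primesEquiv.symm ⟨r, Fact.out⟩, by rw [Equiv.apply_symm_apply]⟩
  rw [← map_WInt]
  exact (hasGoodReductionAtPrime_iff_hasGoodReductionAt_ringOfIntegers v _).2
    (hasGoodReductionAt_map_of_not_dvd _ v (not_dvd_WInt_Δ Fact.out hrp))

/-- **Every prime divisor of `N(W_p⁻)` is `2` or `p`** (no modularity: `not_dvd_conductorNorm_of_hasGoodReductionAtPrime`).
[cite: SilvermanATAEC1994, Thm. IV.10.2(a)] -/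
theorem eq_two_or_eq_of_prime_dvd_conductorNorm_W {p r : ℕ} [(⟨0, 0, 0, -(p : ℚ), 0⟩ : WeierstrassCurve ℚ).IsElliptic]
    (hp : p.Prime) (hr : r.Prime) (h : r ∣ (⟨0, 0, 0, -(p : ℚ), 0⟩ : WeierstrassCurve ℚ).conductorNorm ℤ) :
    r = 2 ∨ r = p := by
  by_contra hne
  push Not at hne
  have hrp : ¬ r ∣ 2 * p := fun hd => by
    rcases (Nat.Prime.dvd_mul hr).mp hd with h2 | hp'
    · exact hne.1 ((Nat.prime_dvd_prime_iff_eq hr Nat.prime_two).mp h2)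
    · exact hne.2 ((Nat.prime_dvd_prime_iff_eq hr hp).mp hp')
  haveI : Fact r.Prime := ⟨hr⟩
  exact not_dvd_conductorNorm_of_hasGoodReductionAtPrime _ (hasGoodReductionAtPrime_W hrp) h

end Family

/-! ## §2 The twist `E = W_p⁻^{(−5q)} : y² = x³ − 25pq²·x`: rank `0`, `Ш[2] = 0`, `corank_{ℤ₂} Sel_{2^∞} = 0` -/

section Twist

variable {p q : ℕ} [hp : Fact p.Prime] [hq : Fact q.Prime]

/-- **Both Selmer sets have two elements**: `S(0, −25pq²) = {1, −p}`, `S′ = S(0, 100pq²) = {1, p}`, so `dim₂ S = dim₂ S′ = 1`.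
[cite: SilvermanAEC2009, Prop. X.4.9 and Prop. X.6.1] -/
theorem twoIsogenySelmerRank_twist (hp8 : p % 8 = 7) (hp5 : p % 5 = 4) (hq8 : q % 8 = 3)
    (hnq : ¬ IsSquare ((q : ℤ) : ZMod p)) :
    twoIsogenySelmerRank 0 (-(25 * p * q ^ 2 : ℤ)) = 1 ∧ twoIsogenySelmerRank' 0 (-(25 * p * q ^ 2 : ℤ)) = 1 := by
  have hP := hp.out
  have h1p : (1 : ℤ) ≠ -(p : ℤ) := by have := hP.one_lt; omega
  have h1p' : (1 : ℤ) ≠ (p : ℤ) := by exact_mod_cast hP.one_lt.ne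
  have hS : twoIsogenySelmerGroup 0 (-(25 * p * q ^ 2 : ℤ)) = {1, -(p : ℤ)} := by
    ext d
    rw [mem_selmer_neg_iff hp8 hp5 hq8 hnq, Finset.mem_insert, Finset.mem_singleton]
  have hS' : twoIsogenySelmerGroup' 0 (-(25 * p * q ^ 2 : ℤ)) = {1, (p : ℤ)} := by
    rw [twoIsogenySelmerGroup'_eq, show (-2 * 0 : ℤ) = 0 by norm_num,
      show ((0 : ℤ) ^ 2 - 4 * (-(25 * p * q ^ 2 : ℤ))) = 100 * p * q ^ 2 by ring]
    ext d
    rw [mem_selmer_pos_iff hp8 hp5 hq8 hnq, Finset.mem_insert, Finset.mem_singleton]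
  refine ⟨?_, ?_⟩
  · rw [twoIsogenySelmerRank, hS, Finset.card_pair h1p]
    exact Nat.log_pow Nat.one_lt_two 1
  · rw [twoIsogenySelmerRank'_eq, hS', Finset.card_pair h1p']
    exact Nat.log_pow Nat.one_lt_two 1

/-- ★ **`rank = 0`, `Ш[2] = 0`, `corank_{ℤ₂} Sel_{2^∞} = 0` for `E : y² = x³ − 25pq²·x`** (`p ≡ 7 (mod 8)`, `p ≡ 4 (mod 5)`, `q ≡ 3 (mod 8)`,
`(q/p) = −1`) — UNCONDITIONAL: the descent via `2`-isogeny is sharp (`dim₂ S + dim₂ S′ = 2 = rank + 2 + dim Ш-parts`), then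
Greenberg's corank identity with `Ш[2^∞] = 0`. The literal `⟨0, ↑0, 0, ↑(−25pq²), 0⟩` is `W_p⁻^{(−5q)}` (`quadraticTwist_W`).
[cite: SilvermanAEC2009, Prop. X.4.7 and Thm. X.4.2(a); Prop. X.6.1] [cite: Greenberg1999LNM, §1 pp. 54–57] -/
theorem rank_sha_corank_twist (hp8 : p % 8 = 7) (hp5 : p % 5 = 4) (hq8 : q % 8 = 3)
    (hnq : ¬ IsSquare ((q : ℤ) : ZMod p))
    [hE : (⟨0, ((0 : ℤ) : ℚ), 0, ((-(25 * p * q ^ 2) : ℤ) : ℚ), 0⟩ : WeierstrassCurve ℚ).IsElliptic] :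
    (⟨0, ((0 : ℤ) : ℚ), 0, ((-(25 * p * q ^ 2) : ℤ) : ℚ), 0⟩ : WeierstrassCurve ℚ).mordellWeilRank = 0 ∧
    (∀ c ∈ (⟨0, ((0 : ℤ) : ℚ), 0, ((-(25 * p * q ^ 2) : ℤ) : ℚ), 0⟩ : WeierstrassCurve ℚ).sha, 2 • c = 0 → c = 0) ∧
    (⟨0, ((0 : ℤ) : ℚ), 0, ((-(25 * p * q ^ 2) : ℤ) : ℚ), 0⟩ : WeierstrassCurve ℚ).selmerCorank 2 = 0 := by
  have hP := hp.out
  have hQ := hq.out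
  have hp0 : (p : ℤ) ≠ 0 := by exact_mod_cast hP.ne_zero
  have hq0 : (q : ℤ) ≠ 0 := by exact_mod_cast hQ.ne_zero
  have hb : (-(25 * p * q ^ 2 : ℤ)) ≠ 0 :=
    neg_ne_zero.mpr (mul_ne_zero (mul_ne_zero (by norm_num) hp0) (pow_ne_zero 2 hq0))
  have hab : (-(25 * p * q ^ 2 : ℤ)) * ((0 : ℤ) ^ 2 - 4 * (-(25 * p * q ^ 2 : ℤ))) ≠ 0 := by
    refine mul_ne_zero hb ?_
    rw [show ((0 : ℤ) ^ 2 - 4 * (-(25 * p * q ^ 2 : ℤ))) = 4 * (25 * p * q ^ 2) by ring]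
    exact mul_ne_zero (by norm_num) (neg_ne_zero.mp hb)
  haveI := isElliptic_halfModel hab
  obtain ⟨h1, h2⟩ := twoIsogenySelmerRank_twist hp8 hp5 hq8 hnq
  have hle : twoIsogenySelmerRank 0 (-(25 * p * q ^ 2 : ℤ)) + twoIsogenySelmerRank' 0 (-(25 * p * q ^ 2 : ℤ)) ≤
      (⟨0, ((0 : ℤ) : ℚ), 0, ((-(25 * p * q ^ 2) : ℤ) : ℚ), 0⟩ : WeierstrassCurve ℚ).mordellWeilRank + 2 := by
    rw [h1, h2]; omega
  obtain ⟨-, -, hsum⟩ := natCard_sha_inf_range_eq_one_of_selmerRank_add_le hab hle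
  have hrank : (⟨0, ((0 : ℤ) : ℚ), 0, ((-(25 * p * q ^ 2) : ℤ) : ℚ), 0⟩ : WeierstrassCurve ℚ).mordellWeilRank = 0 := by
    rw [h1, h2] at hsum; omega
  have hsha := forall_mem_sha_two_smul_eq_zero_of_selmerRank_add_le hab hle
  haveI : Fact (Nat.Prime 2) := ⟨Nat.prime_two⟩
  refine ⟨hrank, hsha, ?_⟩
  rw [(⟨0, ((0 : ℤ) : ℚ), 0, ((-(25 * p * q ^ 2) : ℤ) : ℚ), 0⟩ : WeierstrassCurve ℚ).selmerCorank_eq_mordellWeilRank_add_holds 2,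
    hrank, (⟨0, ((0 : ℤ) : ℚ), 0, ((-(25 * p * q ^ 2) : ℤ) : ℚ), 0⟩ : WeierstrassCurve ℚ).shaCorank_eq_zero_of_forall 2 hsha]

/-- ★ **`L`-form**: `r_an(E) = 0` and `L(E, 1) ≠ 0` for `E : y² = x³ − 25pq²·x` as above, modulo Burungale–Tian (`corank₂ = 0` and CM,
`j(E) = 1728`, give `r_an = 0`; the fact allows the prime `2`) and Deuring–Hecke (`1728 ∈ maximalCMJInvariants`, so `L(E, s)` is entire and
`r_an = 0` reads `L(E,1) ≠ 0`). [cite: BurungaleTian2026, Thm. 1.1] [cite: SilvermanATAEC1994, Ch. II Cor. 10.5.1] -/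
theorem L_one_ne_zero_twist (hBT : burungaleTian_analyticRank_eq_zero_of_selmerCorank_eq_zero_of_hasCM)
    (hH : hasEntireLFunction_of_j_mem_maximalCMJInvariants) (hp8 : p % 8 = 7) (hp5 : p % 5 = 4) (hq8 : q % 8 = 3)
    (hnq : ¬ IsSquare ((q : ℤ) : ZMod p))
    [hE : (⟨0, ((0 : ℤ) : ℚ), 0, ((-(25 * p * q ^ 2) : ℤ) : ℚ), 0⟩ : WeierstrassCurve ℚ).IsElliptic] :
    (⟨0, ((0 : ℤ) : ℚ), 0, ((-(25 * p * q ^ 2) : ℤ) : ℚ), 0⟩ : WeierstrassCurve ℚ).analyticRank = 0 ∧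
    (⟨0, ((0 : ℤ) : ℚ), 0, ((-(25 * p * q ^ 2) : ℤ) : ℚ), 0⟩ : WeierstrassCurve ℚ).entireLFunction 1 ≠ 0 := by
  haveI : Fact (Nat.Prime 2) := ⟨Nat.prime_two⟩
  have hb : (-(25 * p * q ^ 2 : ℤ)) ≠ 0 :=
    neg_ne_zero.mpr (mul_ne_zero (mul_ne_zero (by norm_num) (by exact_mod_cast hp.out.ne_zero))
      (pow_ne_zero 2 (by exact_mod_cast hq.out.ne_zero)))
  obtain ⟨hj, hCM⟩ := j_and_hasCM_lit hb
  obtain ⟨-, -, hcor⟩ := rank_sha_corank_twist hp8 hp5 hq8 hnq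
  have h0 := hBT _ hCM 2 hcor
  refine ⟨h0, (analyticRank_eq_zero_iff_holds (W := (⟨0, ((0 : ℤ) : ℚ), 0, ((-(25 * p * q ^ 2) : ℤ) : ℚ), 0⟩ :
    WeierstrassCurve ℚ)) (hH _ ?_)).1 h0⟩
  rw [hj]
  simp [maximalCMJInvariants]

end Twist

/-! ## §3 ★★ The corner: `W = W_p⁻`, every prime `p ≡ 7 (mod 8)`, `p ≡ 4 (mod 5)` -/

section Corner

/-- From the cell datum `(−5q/p) = +1` with `p ≡ 3 (mod 4)`, `p ≡ ±1 (mod 5)`: `q` is a non-residue mod `p`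
(`(−1/p) = −1`, `(5/p) = +1`). [folklore] -/
theorem not_isSquare_of_jacobiSym_neg_five_mul {p q : ℕ} [hp : Fact p.Prime] (hp4 : p % 4 = 3) (hp5 : p % 5 = 1 ∨ p % 5 = 4)
    (hJ : jacobiSym (-(5 * (q : ℤ))) p = 1) : ¬ IsSquare ((q : ℤ) : ZMod p) := by
  have hP := hp.out
  have hp2 : p ≠ 2 := by rintro rfl; omega
  rw [← legendreSym.eq_neg_one_iff p]
  have hodd : Odd p := hP.odd_of_ne_two hp2
  have hm1 : jacobiSym (-1) p = -1 := by
    rw [jacobiSym.at_neg_one hodd, ZMod.χ₄_nat_three_mod_four hp4]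
  have h5 : jacobiSym 5 p = 1 := by
    rw [← jacobiSym.legendreSym.to_jacobiSym, legendreSym.eq_one_iff]
    · exact isSquare_five hp2 hp5
    · intro h0
      have : (p : ℤ) ∣ 5 := (ZMod.intCast_zmod_eq_zero_iff_dvd 5 p).mp h0
      have h' : p ∣ 5 := by exact_mod_cast this
      rcases (Nat.dvd_prime Nat.prime_five).mp h' with h'' | h'' <;> omega
  have hsplit : jacobiSym (-(5 * (q : ℤ))) p = jacobiSym (-1) p * jacobiSym 5 p * jacobiSym q p := by
    rw [show (-(5 * (q : ℤ))) = (-1) * (5 * q) by ring, jacobiSym.mul_left, jacobiSym.mul_left, mul_assoc]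
  rw [hsplit, hm1, h5] at hJ
  rw [jacobiSym.legendreSym.to_jacobiSym]
  linarith

/-- ★★ **THE QUARTIC CORNER `W = W_p⁻ : y² = x³ − px`, TWO NAMED FACTS: every prime `p ≡ 7 (mod 8)` with `p ≡ 4 (mod 5)`.**
There is a Heegner field `K′` (`= ℚ(√−5q)`, `q ≡ 3 (mod 8)` the cell prime of `exists_cellData_two_p`, `(−5q/p) = +1`) with `4 < |d_{K′}|`,
Heegner for `N(W_p⁻)` (prime support `{2, p}`; `d ≡ 1 (mod 8)`, `(d/p) = +1`), `L(W_p⁻^{(d_{K′})}, 1) ≠ 0` (`W^{(−5q)} : y² = x³ − 25pq²x`,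
sharp `2`-isogeny descent — UNCONDITIONAL — then Burungale–Tian at `2`), `h(K′) < p` and hence `p ∤ h(K′)` — the CONCLUSION of crux 21381
for `W = W_p⁻`, modulo `hBT` (Burungale–Tian) and `hH` (Deuring–Hecke) only. The binders `IsGloballyMinimal`, `NeZero N` mirror the crux
and are unused. [cite: BurungaleTian2026, Thm. 1.1] [cite: SilvermanAEC2009, Prop. X.4.9, Prop. X.4.7, Thm. X.4.2(a)]
[cite: Oesterle1988Gauss, II §3 Proposition p. 57 (27)] -/
theorem cruxOnQuarticCorner_of_two_facts (hBT : burungaleTian_analyticRank_eq_zero_of_selmerCorank_eq_zero_of_hasCM)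
    (hH : hasEntireLFunction_of_j_mem_maximalCMJInvariants) :
    ∀ (p : ℕ) [Fact p.Prime] [(⟨0, 0, 0, -(p : ℚ), 0⟩ : WeierstrassCurve ℚ).IsElliptic]
      [(⟨0, 0, 0, -(p : ℚ), 0⟩ : WeierstrassCurve ℚ).IsGloballyMinimal]
      [NeZero ((⟨0, 0, 0, -(p : ℚ), 0⟩ : WeierstrassCurve ℚ).conductorNorm ℤ)],
      p % 8 = 7 → p % 5 = 4 →
      ∃ (K : Type) (_ : Field K) (_ : NumberField K),
        IsImaginaryQuadratic K ∧ 4 < (NumberField.discr K).natAbs ∧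
        SatisfiesHeegnerHypothesis ((⟨0, 0, 0, -(p : ℚ), 0⟩ : WeierstrassCurve ℚ).conductorNorm ℤ) K ∧
        ((⟨0, 0, 0, -(p : ℚ), 0⟩ : WeierstrassCurve ℚ).quadraticTwist (NumberField.discr K : ℚ)).entireLFunction 1 ≠ 0 ∧
        NumberField.classNumber K < p ∧ ¬ p ∣ NumberField.classNumber K := by
  intro p hpF _ _ _ hp8 hp5
  have hp : p.Prime := hpF.out
  obtain ⟨q, hq, hq8, hqp, -, hJ5, hh⟩ := exists_cellData_two_p hp (by omega) (by omega)
  haveI : Fact q.Prime := ⟨hq⟩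
  have hnq : ¬ IsSquare ((q : ℤ) : ZMod p) := not_isSquare_of_jacobiSym_neg_five_mul (by omega) (Or.inr hp5) hJ5
  obtain ⟨K, iF, iN, hK, hdK, hH', hcl⟩ := exists_witnessField_five_of
    (N := (⟨0, 0, 0, -(p : ℚ), 0⟩ : WeierstrassCurve ℚ).conductorNorm ℤ) hq hq8 hJ5 hh
    (fun r hr hrN => eq_two_or_eq_of_prime_dvd_conductorNorm_W hp hr hrN)
  refine ⟨K, iF, iN, hK, ?_, hH', ?_, hcl, fun hdvd =>
    absurd (Nat.le_of_dvd (NumberField.classNumber_pos K) hdvd) (not_le.mpr hcl)⟩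
  · rw [hdK, Int.natAbs_neg, Int.natAbs_natCast]
    have := hq.two_le
    omega
  · -- `W^{(−5q)} : y² = x³ − 25pq²x`
    rw [hdK, quadraticTwist_W]
    rw [show (-((-((5 * q : ℕ) : ℤ)) ^ 2 * p) : ℤ) = (-(25 * p * q ^ 2) : ℤ) by push_cast; ring]
    have hb : (-(25 * p * q ^ 2 : ℤ)) ≠ 0 :=
      neg_ne_zero.mpr (mul_ne_zero (mul_ne_zero (by norm_num) (by exact_mod_cast hp.ne_zero))
        (pow_ne_zero 2 (by exact_mod_cast hq.ne_zero)))
    have hab : (-(25 * p * q ^ 2 : ℤ)) * ((0 : ℤ) ^ 2 - 4 * (-(25 * p * q ^ 2 : ℤ))) ≠ 0 := by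
      refine mul_ne_zero hb ?_
      rw [show ((0 : ℤ) ^ 2 - 4 * (-(25 * p * q ^ 2 : ℤ))) = 4 * (25 * p * q ^ 2) by ring]
      exact mul_ne_zero (by norm_num) (neg_ne_zero.mp hb)
    haveI := isElliptic_mk_of_ne_zero (F := ℚ) hab
    exact (L_one_ne_zero_twist hBT hH hp8 hp5 hq8 hnq).2

end Corner

end Summit.BirchSwinnertonDyer.BirchSwinnertonDyer.Theorems.BiquadraticEisensteinDescentHeegnerTwistCouplingInSupplyQuarticTwistCorner

end
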